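import Summits.BirchSwinnertonDyer.BirchSwinnertonDyer.Theorems.PrintCf2SplitBadTwoF3LevelLift
import Summits.BirchSwinnertonDyer.BirchSwinnertonDyer.Theorems.PrintCf2SplitBadTwoKummerOutsideLevelLift
import Summits.BirchSwinnertonDyer.BirchSwinnertonDyer.Theorems.PrintCf2SplitBadTwoLevelProjTorsionClasses
import Summits.BirchSwinnertonDyer.Rank1Residual.X11b.KummerTorsionDecomposition
import Summits.BirchSwinnertonDyer.Rank1Residual.X11b.LevelShiftMaps
import Summits.BirchSwinnertonDyer.Rank1Residual.X11b.KummerLocalTorsionSaturation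
import Summits.BirchSwinnertonDyer.Rank1Residual.X11b.BDPRouteLevelToKummerTorsion
import Literature.NumberTheory.EllipticCurves.KummerMap
import HarnessLib

/-!
# Crux `PrintCf2.SplitBadTwoRankOneOfFacts` (stmt-BirchSwinnertonDyer-20368), road α v10.3, S3c input (F3) — the LOCAL PINNING at `v`
# ((PIN)(a) of p680684): the `ẽ_N`-component of every local Kummer class at `v` is the class of a RATIONAL TORSION point —
# from the pinning of lifted point classes ((PIN)(b), p681392) by the DENSITY of the Mordell–Weil line (NO Kummer naturality for `π`)

Cell `bsd-print-cf2`, EXTRA WIDTH seat `bsd-line-cf2-p1-w8` g3 (prover-bsd-line-cf2-p1-w8-g3-0); `--supports stmt-BirchSwinnertonDyer-20368`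
(helper, Theses-free). HONEST FRAMING: nothing here closes the crux or a registered stub; BSD is not proved by any of this; no summit
statement is proved by this seat. No definition, no named fact, no `sorry`, no kit. beyond-print theorem: no.

WHAT (generic: `V/K` elliptic over a number field, `p` prime, `K`-field `E` or finite place `v`, equivariant projector `e` onto
`W* = V.endEigenPrimaryTorsion p π r` with `e|_{W*} = id`, level shadows `eN` (level `p^N`) and `eNc` (level `p^{N+c}`) with `ι ∘ eN = e ∘ ι`):
* §1 `levelIncl_levelProj_comm`, `map_levelIncl_map_levelProj` (shadows commute with `ι : E[p^N] ↪ E[p^{N+c}]`), `map_levelProj_map_levelProj`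
  (idempotence on classes, from -w4 g10 `levelProj_idem_of_primaryInclusion_eq`); §1b `restrictField_apply_nsmul_coe_proj_eq` (the side condition of
  -w4 g10 `RestrictedSelmerPair.map_levelProj_connectingClass`: `H¹(eN) δ(b) = δ(e b)`), **`localKummerMap_baseChange_eq_connectingClass`** /
  `localization_kummerMapTorsion_eq_connectingClass` (the local(ised) Kummer class of a rational point with a `p`-power-torsion root `b` is the
  connecting class `δ(b)` of `0 → E[p^N] → E[p^∞] → E[p^∞] → 0`).
* §2 **`exists_map_levelProj_localKummerMap_eq`** — (PIN)(a) GENERIC: if (i) every local point `Q` satisfies `p^c Q = M • P₀ + p^{N+c} R`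
  (density of the Mordell–Weil line, p677570 §1), (ii) the `eNc`-components of the local Kummer classes `κ_{N+c}(M • P₀)` die in
  `H¹(E, E[p^∞])` ((PIN)(b) at level `N + c`: p681392 `hPINb_holds` read through -w5 g3 `resOfLe_levelLift_eq_zero_iff`), (iii) every
  `Γ_E`-invariant of `W*` is a rational point, THEN for every local Kummer class `κ_N(Q)`: `H¹(eN) κ_N(Q) = κ_N(T)` for a torsion point
  `T ∈ E(K)`. Mechanism: `H¹(ι_N) H¹(eN) κ_N(Q) = H¹(ι_{N+c}) H¹(eNc) κ_{N+c}(p^c Q) = H¹(ι_{N+c}) H¹(eNc) κ_{N+c}(M P₀) = 0`, so `H¹(eN) κ_N(Q) = δ(b)`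
  is a connecting class (X11b `map_primaryInclusion_restrictField_eq_zero_iff`), `= H¹(eN) δ(b) = δ(e b)` by idempotence, and
  `p^N · e b ∈ W*^{Γ_E}` is a rational torsion point `T` with `κ_N(T) = δ(e b)`. NO Kummer naturality for `π` is used.
* §3 **`exists_map_levelProj_eq_localization_kummerMapTorsion`** — the same at a finite place `v` of `K` in the currency of the displayed
  hypothesis `hPIN` (a) of p680684 `hcounts_of_pointIndex_of_pinning_of_finiteSha` (`c ∈ kummerSelmerStructure (p^N) v`,
  `H¹(eN|K_v) c = loc_v κ_N(T)`), the pinning hypothesis in `loc_v`-form. Consumer: this seat's next file (`hPIN_holds` on the S3c frames: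
  density at `v` from `E(K_v) ⊇ ℤ₂`, (iii) from -w2 g9 `natCard_fixedPoints_decomp_v_eq_two_of_frame` + descent as in -w3 g10).
presearch: Greenberg LNM 1716 §2/§5, JSW17 §3.3.1 (torsion Kummer classes = connecting classes) — tree theorems (X11b); no new fact.

References: [GreenbergLNM1716] §2 (p. 62), §5 proof of Prop. 5.8; [JetchevSkinnerWan2017] §3.3.1; [SilvermanAEC2009] VIII §2; [Rubin1999] §2.
-/

noncomputable section

open scoped Classical

set_option linter.dupNamespace false
set_option autoImplicit false

open CategoryTheory Function Field NumberField IsDedekindDomain WeierstrassCurve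
open Literature.NumberTheory.EllipticCurves Literature.NumberTheory.EllipticCurves.GreenbergSelmer
open Literature.NumberTheory.GaloisRepresentations
open Literature.NumberTheory.GaloisCohomology
open scoped ContRepresentation
open Summit.BirchSwinnertonDyer.Rank1Residual.X11b
open Summit.BirchSwinnertonDyer.Rank1Residual.X11b.LocBridge
open Summit.BirchSwinnertonDyer.Rank1Residual.X11b.Levels
open Summit.BirchSwinnertonDyer.Rank1Residual.X11b.AcSelmer
open Summit.BirchSwinnertonDyer.Rank1Residual.X11b.LevelKummer

open Summit.BirchSwinnertonDyer.BirchSwinnertonDyer.Theorems.PrintCf2.RestrictedSelmerPair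

namespace Summit.BirchSwinnertonDyer.BirchSwinnertonDyer.Theorems.PrintCf2.SelmerLocImage

/-! ## §1. Level shadows: commutation with `ι`, idempotence, connecting classes -/

section Shadows

variable {K : Type} [Field K] (V : WeierstrassCurve K) (p : ℕ) [hp : Fact p.Prime] (π : V.endRing) (r : ℤ_[p]) (N c : ℕ)
  (e : V.geomPrimaryTorsion p →+ ↥(V.endEigenPrimaryTorsion p π r))
  (he₁ : ∀ x : ↥(V.endEigenPrimaryTorsion p π r), e x = x)
  (eN : (V.torsionGaloisModule ((p ^ N : ℕ) : ℤ)).toContRepresentation →ⁱL (V.torsionGaloisModule ((p ^ N : ℕ) : ℤ)).toContRepresentation)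
  (heN : ∀ y, primaryInclusion V p N (eN y) = (e (primaryInclusion V p N y) : V.geomPrimaryTorsion p))
  (eNc : (V.torsionGaloisModule ((p ^ (N + c) : ℕ) : ℤ)).toContRepresentation →ⁱL
    (V.torsionGaloisModule ((p ^ (N + c) : ℕ) : ℤ)).toContRepresentation)
  (heNc : ∀ y, primaryInclusion V p (N + c) (eNc y) = (e (primaryInclusion V p (N + c) y) : V.geomPrimaryTorsion p))

include heN heNc in
/-- Level shadows commute with `ι : E[p^N] ↪ E[p^{N+c}]` (both sides have `ι_{N+c}`-image `e(ι_N y)`; `ι_{N+c}` is injective). [folklore] -/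
theorem levelIncl_levelProj_comm (y : V.geomTorsion ((p ^ N : ℕ) : ℤ)) : levelIncl V p N c (eN y) = eNc (levelIncl V p N c y) := by
  apply primaryInclusion_injective V p (N + c)
  rw [primaryInclusion_levelIncl, heN, heNc, primaryInclusion_levelIncl]

include heN heNc in
/-- On `H¹` over any `K`-field: `H¹(ι) ∘ H¹(eN) = H¹(eNc) ∘ H¹(ι)`. [cite: SerreGaloisCohomology1997, I §2.4] -/
theorem map_levelIncl_map_levelProj (E : Type) [Field E] [Algebra K E]
    (a : galoisCohomology (GaloisRep.restrictField E (V.torsionGaloisModule ((p ^ N : ℕ) : ℤ))) 1) :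
    galoisCohomology.map ((levelIncl V p N c).restrictField E) 1 (galoisCohomology.map (eN.restrictField E) 1 a) =
      galoisCohomology.map (eNc.restrictField E) 1 (galoisCohomology.map ((levelIncl V p N c).restrictField E) 1 a) := by
  obtain ⟨φ, rfl⟩ := oneCocycleClass_surjective _ a
  rw [galoisCohomology.map_one_oneCocycleClass, galoisCohomology.map_one_oneCocycleClass,
    galoisCohomology.map_one_oneCocycleClass, galoisCohomology.map_one_oneCocycleClass]
  congr 1
  refine Subtype.ext (ContinuousMap.ext fun σ ↦ ?_)
  exact levelIncl_levelProj_comm V p π r N c e eN heN eNc heNc (φ.1 σ)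

include he₁ heN in
/-- Idempotence on `H¹` over any `K`-field: `H¹(eN) (H¹(eN) a) = H¹(eN) a`. [cite: SerreGaloisCohomology1997, I §2.4] -/
theorem map_levelProj_map_levelProj (E : Type) [Field E] [Algebra K E]
    (a : galoisCohomology (GaloisRep.restrictField E (V.torsionGaloisModule ((p ^ N : ℕ) : ℤ))) 1) :
    galoisCohomology.map (eN.restrictField E) 1 (galoisCohomology.map (eN.restrictField E) 1 a) =
      galoisCohomology.map (eN.restrictField E) 1 a := by
  obtain ⟨φ, rfl⟩ := oneCocycleClass_surjective _ a
  rw [galoisCohomology.map_one_oneCocycleClass, galoisCohomology.map_one_oneCocycleClass]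
  congr 1
  refine Subtype.ext (ContinuousMap.ext fun σ ↦ ?_)
  exact levelProj_idem_of_primaryInclusion_eq V p N π r e he₁ eN heN (φ.1 σ)

end Shadows

/-! ## §1b. The projector on connecting classes; localised Kummer classes of rational points as connecting classes -/

section Connecting

variable {K : Type} [Field K] (V : WeierstrassCurve K) (p : ℕ) [hp : Fact p.Prime] (π : V.endRing) (r : ℤ_[p]) (N : ℕ)
  (e : V.geomPrimaryTorsion p →+ ↥(V.endEigenPrimaryTorsion p π r))
  (he : ∀ (σ : absoluteGaloisGroup K) (x : V.geomPrimaryTorsion p), e (σ • x) = σ • e x)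
  (eN : (V.torsionGaloisModule ((p ^ N : ℕ) : ℤ)).toContRepresentation →ⁱL (V.torsionGaloisModule ((p ^ N : ℕ) : ℤ)).toContRepresentation)
  (heN : ∀ y, primaryInclusion V p N (eN y) = (e (primaryInclusion V p N y) : V.geomPrimaryTorsion p))
  (E : Type) [Field E] [Algebra K E]

include he in
/-- An equivariant projector preserves the `Γ_E`-invariance of `p^N • b` (`e` is additive and `Γ_K`-equivariant, `Γ_E → Γ_K`). [folklore] -/
theorem restrictField_apply_nsmul_coe_proj_eq (b : V.geomPrimaryTorsion p)
    (hb : ∀ σ : absoluteGaloisGroup E, GaloisRep.restrictField E (primaryGaloisModule V p) σ (p ^ N • b) = p ^ N • b)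
    (σ : absoluteGaloisGroup E) :
    GaloisRep.restrictField E (primaryGaloisModule V p) σ (p ^ N • (e b : V.geomPrimaryTorsion p)) =
      p ^ N • (e b : V.geomPrimaryTorsion p) := by
  have h := congrArg (fun x : V.geomPrimaryTorsion p ↦ (e x : V.geomPrimaryTorsion p)) (hb σ)
  change (e (absGaloisRestrict K E σ • (p ^ N • b)) : V.geomPrimaryTorsion p) = _ at h
  rw [he, endEigenPrimaryTorsion.coe_smul, map_nsmul, AddSubmonoidClass.coe_nsmul] at h
  exact h

end Connecting

section RationalClasses

variable {K : Type} [Field K] [NumberField K] (V : WeierstrassCurve K) [V.IsElliptic] (p : ℕ) [hp : Fact p.Prime] (N : ℕ)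
  (E : Type) [Field E] [Algebra K E] [CharZero E]

omit [NumberField K] [V.IsElliptic] hp [CharZero E] in
/-- If `p^N • b` is (the image of) a rational point then it is `Γ_E`-fixed in `E[p^∞]|_{Γ_E}`. [folklore] -/
theorem restrictField_apply_nsmul_eq_of_coe_eq_toGeomPoints (b : V.geomPrimaryTorsion p) (T : V.toAffine.Point)
    (hbT : (((p ^ N • b : V.geomPrimaryTorsion p)) : V.geomPoints) = toGeomPoints V T) (σ : absoluteGaloisGroup E) :
    GaloisRep.restrictField E (primaryGaloisModule V p) σ (p ^ N • b) = p ^ N • b := by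
  apply Subtype.ext
  change absGaloisRestrict K E σ • (((p ^ N • b : V.geomPrimaryTorsion p)) : V.geomPoints) = _
  rw [hbT, smul_toGeomPoints]

omit hp [CharZero E] in
/-- **The local Kummer class of a rational point with a `p`-power-torsion root is a connecting class**: if `p^N • b = T` in `E(K̄)` with
`b ∈ E[p^∞]` and `T ∈ E(K)`, then over every `K`-field `E` (of characteristic `0`) `κ_{p^N,E}(T) = δ(b)` for the connecting class of
`0 → E[p^N] → E[p^∞] → E[p^∞] → 0` (X11b `connectingClass_eq_localKummerClass` + tree `localKummerMap_eq_localKummerClass`).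
[cite: SilvermanAEC2009, VIII §2] [cite: GreenbergLNM1716, §5 proof of Prop. 5.8] -/
theorem localKummerMap_baseChange_eq_connectingClass (hn : ((p ^ N : ℕ) : ℤ) ≠ 0) (b : V.geomPrimaryTorsion p) (T : V.toAffine.Point)
    (hbT : (((p ^ N • b : V.geomPrimaryTorsion p)) : V.geomPoints) = toGeomPoints V T)
    (hb : ∀ σ : absoluteGaloisGroup E, GaloisRep.restrictField E (primaryGaloisModule V p) σ (p ^ N • b) = p ^ N • b) :
    V.localKummerMap E hn (Affine.Point.baseChange (W' := V) K E T) =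
      connectingClass ((primaryInclusion V p N).restrictField E) (p ^ N)
        (exists_primaryInclusion_restrictField_eq_of_nsmul_eq_zero V p N E)
        (primaryInclusion_restrictField_injective V p N E) b hb := by
  rw [connectingClass_eq_localKummerClass V p N E b hb hn]
  refine V.localKummerMap_eq_localKummerClass E hn _ _ _ ?_
  rw [KummerIndex.baseChangeGeomPointsEquiv_toGeomPoints_baseChange, ← hbT, AddSubmonoidClass.coe_nsmul, map_nsmul, natCast_zsmul]

omit hp in
/-- **Localised form** at a finite place `v` of `K`: `loc_v κ_N(T) = δ(b)` in `H¹(K_v, E[p^N])` (X11b `res_kummerMapTorsion_eq_localKummerMap`).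
[cite: SilvermanAEC2009, X §4 diagram (**)] -/
theorem localization_kummerMapTorsion_eq_connectingClass (v : HeightOneSpectrum (𝓞 K)) (hn : ((p ^ N : ℕ) : ℤ) ≠ 0)
    (hdiv : ∀ P : V.geomPoints, ∃ Q : V.geomPoints, ((p ^ N : ℕ) : ℤ) • Q = P) (b : V.geomPrimaryTorsion p) (T : V.toAffine.Point)
    (hbT : (((p ^ N • b : V.geomPrimaryTorsion p)) : V.geomPoints) = toGeomPoints V T)
    (hb : ∀ σ : absoluteGaloisGroup (v.adicCompletion K),
      GaloisRep.restrictField (v.adicCompletion K) (primaryGaloisModule V p) σ (p ^ N • b) = p ^ N • b) :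
    galoisCohomology.localization (V.torsionGaloisModule ((p ^ N : ℕ) : ℤ)) (Sum.inr v) 1 (kummerMapTorsion V ((p ^ N : ℕ) : ℤ) hdiv T) =
      connectingClass ((primaryInclusion V p N).restrictField (v.adicCompletion K)) (p ^ N)
        (exists_primaryInclusion_restrictField_eq_of_nsmul_eq_zero V p N (v.adicCompletion K))
        (primaryInclusion_restrictField_injective V p N (v.adicCompletion K)) b hb := by
  haveI : CharZero (v.adicCompletion K) := charZero_placeCompletion (K := K) (Sum.inr v)
  rw [← localKummerMap_baseChange_eq_connectingClass V p N (v.adicCompletion K) hn b T hbT hb]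
  exact KummerIndex.res_kummerMapTorsion_eq_localKummerMap V (v.adicCompletion K) hn hdiv T

end RationalClasses

/-! ## §2. (PIN)(a), generic: the `eN`-component of every local Kummer class is the class of a rational torsion point -/

section Pinning

variable {K : Type} [Field K] [NumberField K] (V : WeierstrassCurve K) [V.IsElliptic] (p : ℕ) [hp : Fact p.Prime]
  (π : V.endRing) (r : ℤ_[p]) (N c : ℕ)
  (e : V.geomPrimaryTorsion p →+ ↥(V.endEigenPrimaryTorsion p π r))
  (he₁ : ∀ x : ↥(V.endEigenPrimaryTorsion p π r), e x = x)
  (he : ∀ (σ : absoluteGaloisGroup K) (x : V.geomPrimaryTorsion p), e (σ • x) = σ • e x)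
  (eN : (V.torsionGaloisModule ((p ^ N : ℕ) : ℤ)).toContRepresentation →ⁱL (V.torsionGaloisModule ((p ^ N : ℕ) : ℤ)).toContRepresentation)
  (heN : ∀ y, primaryInclusion V p N (eN y) = (e (primaryInclusion V p N y) : V.geomPrimaryTorsion p))
  (eNc : (V.torsionGaloisModule ((p ^ (N + c) : ℕ) : ℤ)).toContRepresentation →ⁱL
    (V.torsionGaloisModule ((p ^ (N + c) : ℕ) : ℤ)).toContRepresentation)
  (heNc : ∀ y, primaryInclusion V p (N + c) (eNc y) = (e (primaryInclusion V p (N + c) y) : V.geomPrimaryTorsion p))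
  (E : Type) [Field E] [Algebra K E] [CharZero E]

include he₁ he heN heNc in
/-- **(PIN)(a), GENERIC FORM — the `eN`-component of every local Kummer class at `E ⊇ K` is the local Kummer class of a RATIONAL TORSION
point.** Data: an equivariant projector `e` of `E[p^∞]` onto `W* = V.endEigenPrimaryTorsion p π r` (`e|_{W*} = id`) with level shadows
`eN` (level `p^N`) and `eNc` (level `p^{N+c}`). Hypotheses: (i) DENSITY of the line `ℤ·P₀` in `E(E)` at scale `c`
(`p^c Q = M·P₀ + p^{N+c} Q′` for every `Q ∈ E(E)` — p677570 `exists_pow_nsmul_eq_zsmul_add` for `E(K_v) ⊇ ℤ_p` of finite index);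
(ii) PINNING of the line at level `N + c` (`H¹(ι_{N+c}) H¹(eNc) κ_{N+c}(M·P₀) = 0` in `H¹(E, E[p^∞])` — (PIN)(b), p681392 `hPINb_holds`);
(iii) every `Γ_E`-invariant of `W*` is (the image of) a `K`-rational point. THEN for every `Q ∈ E(E)` there is a torsion point
`T ∈ E(K)` with `H¹(eN) κ_N(Q) = κ_N(T)`. Proof: `H¹(ι_N) H¹(eN) κ_N(Q) = H¹(ι_{N+c}) H¹(eNc) H¹(ι) κ_N(Q) = H¹(ι_{N+c}) H¹(eNc) κ_{N+c}(p^c Q)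
= H¹(ι_{N+c}) H¹(eNc) κ_{N+c}(M·P₀) = 0` (§1, X11b `map_primaryInclusion_map_levelIncl_restrictField`, p679115 `map_levelIncl_localKummerMap`,
tree `ker_localKummerMap`); so `H¹(eN) κ_N(Q) = δ(b)` is a connecting class (X11b `map_primaryInclusion_restrictField_eq_zero_iff`), `eN` is
idempotent so `δ(b) = H¹(eN) δ(b) = δ(e b)` (§1b), and `p^N · e b ∈ W*^{Γ_E}` is a rational point `T`, torsion since `e b ∈ E[p^∞]`, with
`κ_N(T) = δ(e b)` (§1b). NO Kummer naturality for `π` is used. [cite: GreenbergLNM1716, §5 proof of Prop. 5.8]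
[cite: JetchevSkinnerWan2017, §3.3.1 (arXiv:1512.06894 p. 11)] [cite: SilvermanAEC2009, VIII §2, X §4 diagram (**)] -/
theorem exists_map_levelProj_localKummerMap_eq (hN : ((p ^ N : ℕ) : ℤ) ≠ 0) (hNc : ((p ^ (N + c) : ℕ) : ℤ) ≠ 0) (P₀ : V.toAffine.Point)
    (hdense : ∀ y : (V.baseChange E).toAffine.Point, ∃ (M : ℤ) (y' : (V.baseChange E).toAffine.Point),
      p ^ c • y = M • Affine.Point.baseChange (W' := V) K E P₀ + p ^ (N + c) • y')
    (hpinb : ∀ M : ℤ, galoisCohomology.map ((primaryInclusion V p (N + c)).restrictField E) 1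
      (galoisCohomology.map (eNc.restrictField E) 1 (V.localKummerMap E hNc (M • Affine.Point.baseChange (W' := V) K E P₀))) = 0)
    (hfix : ∀ x : ↥(V.endEigenPrimaryTorsion p π r),
      (∀ σ : absoluteGaloisGroup E, GaloisRep.restrictField E (primaryGaloisModule V p) σ (x : V.geomPrimaryTorsion p) = x) →
      ∃ T : V.toAffine.Point, ((x : V.geomPrimaryTorsion p) : V.geomPoints) = toGeomPoints V T)
    (Q : (V.baseChange E).toAffine.Point) :
    ∃ T : V.toAffine.Point, IsOfFinAddOrder T ∧
      galoisCohomology.map (eN.restrictField E) 1 (V.localKummerMap E hN Q) = V.localKummerMap E hN (Affine.Point.baseChange (W' := V) K E T) := by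
  obtain ⟨M, y', hQ⟩ := hdense Q
  -- Step 1: `H¹(ι_N) H¹(eN) κ_N(Q) = 0`
  have h2 : V.localKummerMap E hNc (((p ^ c : ℕ) : ℤ) • Q) = V.localKummerMap E hNc (M • Affine.Point.baseChange (W' := V) K E P₀) := by
    have hy' : V.localKummerMap E hNc (((p ^ (N + c) : ℕ) : ℤ) • y') = 0 := by
      have hmem : ((p ^ (N + c) : ℕ) : ℤ) • y' ∈ (V.localKummerMap E hNc).ker := by
        rw [V.ker_localKummerMap E hNc]
        exact ⟨y', rfl⟩
      exact (AddMonoidHom.mem_ker).mp hmem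
    rw [natCast_zsmul, hQ, map_add, ← natCast_zsmul, hy', add_zero]
  have h3 : galoisCohomology.map ((primaryInclusion V p N).restrictField E) 1
      (galoisCohomology.map (eN.restrictField E) 1 (V.localKummerMap E hN Q)) = 0 := by
    rw [← map_primaryInclusion_map_levelIncl_restrictField V p N c E, map_levelIncl_map_levelProj V p π r N c e eN heN eNc heNc E,
      map_levelIncl_localKummerMap V p N c E hN hNc, h2]
    exact hpinb M
  -- Step 2: a connecting class, fixed by the idempotent `eN`
  obtain ⟨b, hb, hcl⟩ := (map_primaryInclusion_restrictField_eq_zero_iff V p N E _).mp h3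
  have hb' := restrictField_apply_nsmul_coe_proj_eq V p π r N e he E b hb
  have h5 : galoisCohomology.map (eN.restrictField E) 1 (V.localKummerMap E hN Q) =
      connectingClass ((primaryInclusion V p N).restrictField E) (p ^ N)
        (exists_primaryInclusion_restrictField_eq_of_nsmul_eq_zero V p N E)
        (primaryInclusion_restrictField_injective V p N E) (e b : V.geomPrimaryTorsion p) hb' := by
    rw [← map_levelProj_map_levelProj V p π r N e he₁ eN heN E, hcl]
    exact map_levelProj_connectingClass V p N π r e he eN heN E b hb hb'
  -- Step 3: `p^N • e b ∈ W*^{Γ_E}` is a rational torsion point `T`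
  obtain ⟨T, hT⟩ := hfix (p ^ N • e b) (fun σ ↦ by rw [AddSubmonoidClass.coe_nsmul]; exact hb' σ)
  have hbT : (((p ^ N • (e b : V.geomPrimaryTorsion p) : V.geomPrimaryTorsion p)) : V.geomPoints) = toGeomPoints V T := by
    rw [← hT]
    simp only [AddSubmonoidClass.coe_nsmul]
  have hTfin : IsOfFinAddOrder T := by
    obtain ⟨j, hj⟩ := (AddCommGroup.mem_primaryComponent (G := V.geomPoints)).mp (e b : V.geomPrimaryTorsion p).2
    refine isOfFinAddOrder_iff_nsmul_eq_zero.mpr ⟨p ^ j, pow_pos hp.out.pos j, toGeomPoints_injective V ?_⟩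
    rw [map_nsmul, map_zero, ← hbT, AddSubmonoidClass.coe_nsmul, smul_comm, hj, smul_zero]
  refine ⟨T, hTfin, ?_⟩
  rw [h5, localKummerMap_baseChange_eq_connectingClass V p N E hN (e b : V.geomPrimaryTorsion p) T hbT hb']

end Pinning

/-! ## §3. (PIN)(a) at a finite place `v` of `K`, in the currency of the displayed hypothesis `hPIN` of p680684 -/

section AtPlace

variable {K : Type} [Field K] [NumberField K] (V : WeierstrassCurve K) [V.IsElliptic] (p : ℕ) [hp : Fact p.Prime]
  (π : V.endRing) (r : ℤ_[p]) (N c : ℕ)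
  (e : V.geomPrimaryTorsion p →+ ↥(V.endEigenPrimaryTorsion p π r))
  (he₁ : ∀ x : ↥(V.endEigenPrimaryTorsion p π r), e x = x)
  (he : ∀ (σ : absoluteGaloisGroup K) (x : V.geomPrimaryTorsion p), e (σ • x) = σ • e x)
  (eN : (V.torsionGaloisModule ((p ^ N : ℕ) : ℤ)).toContRepresentation →ⁱL (V.torsionGaloisModule ((p ^ N : ℕ) : ℤ)).toContRepresentation)
  (heN : ∀ y, primaryInclusion V p N (eN y) = (e (primaryInclusion V p N y) : V.geomPrimaryTorsion p))
  (eNc : (V.torsionGaloisModule ((p ^ (N + c) : ℕ) : ℤ)).toContRepresentation →ⁱL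
    (V.torsionGaloisModule ((p ^ (N + c) : ℕ) : ℤ)).toContRepresentation)
  (heNc : ∀ y, primaryInclusion V p (N + c) (eNc y) = (e (primaryInclusion V p (N + c) y) : V.geomPrimaryTorsion p))

include he₁ he heN heNc in
/-- **(PIN)(a) AT A FINITE PLACE `v`.** With the density of `ℤ·P₀` in `E(K_v)` at scale `c`, the pinning
`H¹(ι_{N+c}|K_v) H¹(eNc|K_v) loc_v κ_{N+c}(M·P₀) = 0` for all `M` (the `K_v`-reading of (PIN)(b) through -w5 g3 `resOfLe_levelLift_eq_zero_iff`),
and the descent of `W*^{Γ_{K_v}}` to `E(K)`: every class `c` of the local Kummer condition `𝓚_v^{(p^N)} = kummerSelmerStructure (p^N) v` has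
`H¹(eN|K_v) c = loc_v κ_N(T)` for a TORSION point `T ∈ E(K)` — conjunct (a) of the displayed hypothesis `hPIN` of
`hcounts_of_pointIndex_of_pinning_of_finiteSha` (p680684), for any admissible root datum `hdiv` of `κ_N`.
[cite: GreenbergLNM1716, §5 proof of Prop. 5.8] [cite: JetchevSkinnerWan2017, §3.3.1 (arXiv:1512.06894 p. 11)] [cite: SilvermanAEC2009, X §4 diagram (**)] -/
theorem exists_map_levelProj_eq_localization_kummerMapTorsion (v : HeightOneSpectrum (𝓞 K))
    (hN : ((p ^ N : ℕ) : ℤ) ≠ 0) (hNc : ((p ^ (N + c) : ℕ) : ℤ) ≠ 0)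
    (hdiv : ∀ P : V.geomPoints, ∃ Q : V.geomPoints, ((p ^ N : ℕ) : ℤ) • Q = P)
    (hdivc : ∀ P : V.geomPoints, ∃ Q : V.geomPoints, ((p ^ (N + c) : ℕ) : ℤ) • Q = P) (P₀ : V.toAffine.Point)
    (hdense : ∀ y : (V.baseChange (v.adicCompletion K)).toAffine.Point, ∃ (M : ℤ) (y' : (V.baseChange (v.adicCompletion K)).toAffine.Point),
      p ^ c • y = M • Affine.Point.baseChange (W' := V) K (v.adicCompletion K) P₀ + p ^ (N + c) • y')
    (hpinb : ∀ M : ℤ, galoisCohomology.map ((primaryInclusion V p (N + c)).restrictField (v.adicCompletion K)) 1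
      (galoisCohomology.map (eNc.restrictField (v.adicCompletion K)) 1
        (galoisCohomology.localization (V.torsionGaloisModule ((p ^ (N + c) : ℕ) : ℤ)) (Sum.inr v) 1
          (kummerMapTorsion V ((p ^ (N + c) : ℕ) : ℤ) hdivc (M • P₀)))) = 0)
    (hfix : ∀ x : ↥(V.endEigenPrimaryTorsion p π r),
      (∀ σ : absoluteGaloisGroup (v.adicCompletion K),
        GaloisRep.restrictField (v.adicCompletion K) (primaryGaloisModule V p) σ (x : V.geomPrimaryTorsion p) = x) →
      ∃ T : V.toAffine.Point, ((x : V.geomPrimaryTorsion p) : V.geomPoints) = toGeomPoints V T)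
    (cl : galoisCohomology (GaloisRep.restrictField (Place.Completion (Sum.inr v : Place K)) (V.torsionGaloisModule ((p ^ N : ℕ) : ℤ))) 1)
    (hcl : cl ∈ V.kummerSelmerStructure ((p ^ N : ℕ) : ℤ) (Sum.inr v)) :
    ∃ T : V.toAffine.Point, IsOfFinAddOrder T ∧
      galoisCohomology.map (eN.restrictField (Place.Completion (Sum.inr v : Place K))) 1 cl =
        galoisCohomology.localization (V.torsionGaloisModule ((p ^ N : ℕ) : ℤ)) (Sum.inr v) 1 (kummerMapTorsion V ((p ^ N : ℕ) : ℤ) hdiv T) := by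
  haveI : CharZero (v.adicCompletion K) := charZero_placeCompletion (K := K) (Sum.inr v)
  -- `cl = κ_{N,v}(Q)`
  have hcl' : cl ∈ (V.localKummerMap (v.adicCompletion K) hN).range := by
    rw [V.range_localKummerMap (v.adicCompletion K) hN]
    exact hcl
  obtain ⟨Q, rfl⟩ := hcl'
  -- the pinning read on `E(K_v)`
  have hpinb' : ∀ M : ℤ, galoisCohomology.map ((primaryInclusion V p (N + c)).restrictField (v.adicCompletion K)) 1
      (galoisCohomology.map (eNc.restrictField (v.adicCompletion K)) 1
        (V.localKummerMap (v.adicCompletion K) hNc (M • Affine.Point.baseChange (W' := V) K (v.adicCompletion K) P₀))) = 0 := by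
    intro M
    have hb : Affine.Point.baseChange (W' := V) K (v.adicCompletion K) (M • P₀) =
        M • Affine.Point.baseChange (W' := V) K (v.adicCompletion K) P₀ := map_zsmul _ _ _
    rw [← hb, ← KummerIndex.res_kummerMapTorsion_eq_localKummerMap V (v.adicCompletion K) hNc hdivc (M • P₀)]
    exact hpinb M
  obtain ⟨T, hT, hcl⟩ := exists_map_levelProj_localKummerMap_eq V p π r N c e he₁ he eN heN eNc heNc (v.adicCompletion K) hN hNc P₀
    hdense hpinb' hfix Q
  exact ⟨T, hT, hcl.trans (KummerIndex.res_kummerMapTorsion_eq_localKummerMap V (v.adicCompletion K) hN hdiv T).symm⟩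

end AtPlace

end Summit.BirchSwinnertonDyer.BirchSwinnertonDyer.Theorems.PrintCf2.SelmerLocImage

end
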